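import Literature.Analysis.FluidPDE.KochTataruKernelFourier
import Literature.Analysis.FunctionSpaces.PlancherelL1L2
import HarnessLib

/-!
# The Oseen–Leray symbol in `ℓ²`, the kernel in an orthonormal basis, and Parseval

Analysis/FluidPDE proof companion of `Literature/Analysis/FluidPDE/KochTataru.lean` (decomposition
of `Literature.Analysis.FluidPDE.koch_tataru`, **ns.S15**, Koch–Tataru, Adv. Math. 157 (2001),
Theorem 2). The one named fact left in the bilinear estimate (L1) is the near-field `L²` estimate
`kochTataruBilinear_nearCarleson` (`KochTataruCarleson.lean`; Koch–Tataru's (13), Steps 3–5 /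
Remark 3.3). Its proof runs on the Fourier side: `KochTataruKernelFourier.lean` computes the
multiplier `𝓕⟪K(τ,·)[a,b], c⟫ = 2πi ⟪ξ,a⟫ e^{-(2π)²τ|ξ|²} ⟪P(ξ)b, c⟫` and `KochTataruEnergy.lean`
proves (20) and the frequency-wise energy inequality (21). This file adds the three remaining
pointwise / abstract ingredients, all **proved** and free of new definitions:

* `sum_norm_sq_sum_oseenSymbol_mul_le` (**`Π` is dispensable**, Koch–Tataru 2001, Lemma 3.2
  Step 3: "we have dispensed with `Π`, which is a bounded operator in `L²`"): for an orthonormal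
  basis `e` and complex coefficients `W_{kl}`,
  `∑_j |∑_{k,l} 2πi ⟪ξ,e_k⟫⟪P(ξ)e_l, e_j⟫ W_{kl}|² ≤ (2π)²|ξ|² ∑_{k,l}|W_{kl}|²`, i.e. after expanding
  `B(u,v)` in components the symbol costs at most `2π|ξ|` in `ℓ²`, uniformly in `ξ`
  (`norm_leraySymbol_apply_le` and Cauchy–Schwarz);
* `oseenKernel_eq_sum_orthonormalBasis`, `inner_oseenKernel_eq_sum_orthonormalBasis`,
  `enorm_sq_eq_sum_enorm_inner_sq`: `K(τ,z)[u,v] = ∑_{k,l} ⟪e_k,u⟫⟪e_l,v⟫ K(τ,z)[e_k,e_l]`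
  (bilinearity, through `LinearMap.mk₂`) and `‖w‖² = ∑_j ⟪w,e_j⟫²` in `ℝ≥0∞`;
* `re_integral_inner_fourier_eq`, `re_integral_conj_fourier_mul_eq` (**Parseval, real part**,
  for `L¹ ∩ L²` functions): `Re ∫ ⟪𝓕f, 𝓕g⟫ = Re ∫ ⟪f, g⟫`, by polarising the tree's Plancherel
  identity `Literature.Analysis.FunctionSpaces.integral_norm_sq_fourierIntegral_eq` at `f + g`
  (this is the step `∫ conj(𝓕Vg) 𝓕g dξ = ∫ (Vg) g dx` of Remark 3.3); and
  `memLp_two_of_integrable_of_bound` (`L¹ ∩ L^∞ ⊆ L²`).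

## Mathlib / tree search

Tree: `leraySymbol` (`LerayProjector.lean`), `norm_leraySymbol_apply_le`,
`fourier_inner_oseenKernel_eq_leraySymbol` (`KochTataruKernelFourier.lean`), `oseenKernel_add_left/…`
(`KochTataru.lean`), `FunctionSpaces.integral_norm_sq_fourierIntegral_eq`,
`memLp_two_fourierIntegral` (`PlancherelL1L2.lean`). Mathlib: `OrthonormalBasis.sum_repr'`,
`OrthonormalBasis.sum_sq_inner_left/right`, `Finset.sum_mul_sq_le_sq_mul_sq`, `LinearMap.mk₂`,
`norm_add_sq`, `integral_re`, `memLp_two_iff_integrable_sq_norm`, `norm_inner_le_norm`. Mathlib's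
`Lp.fourierTransformₗᵢ` gives Parseval on `L²` classes; the function-level real-part form for
`L¹ ∩ L²` representatives is not there. Nothing is duplicated
(`lean search 'oseenSymbol|sum_orthonormalBasis|re_integral_inner_fourier|memLp_two_of_integrable'`).

## References

* H. Koch, D. Tataru, *Well-posedness for the Navier–Stokes equations*, Adv. Math. 157 (2001)
  22–35, §2 ((5)–(8)), §3 ((11), Lemma 3.2 Step 3, Remark 3.3). Bib key `KochTataruAdvMath2001`.
-/

noncomputable section

open MeasureTheory Set Function Filter Topology Metric Real
open scoped ENNReal NNReal RealInnerProductSpace FourierTransform ComplexConjugate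

namespace Literature.Analysis.FluidPDE

variable {E : Type*} [NormedAddCommGroup E] [InnerProductSpace ℝ E] [FiniteDimensional ℝ E]
  [MeasurableSpace E] [BorelSpace E]

/-! ## The `ℓ²` bound on the Oseen–Leray symbol -/

section Symbol

omit [FiniteDimensional ℝ E] [MeasurableSpace E] [BorelSpace E] in
/-- `‖r + s i‖² = r² + s²` for real `r`, `s`. [folklore] -/
theorem norm_sq_ofReal_add_ofReal_mul_I (r s : ℝ) :
    ‖(r : ℂ) + (s : ℂ) * Complex.I‖ ^ 2 = r ^ 2 + s ^ 2 := by
  rw [Complex.sq_norm, Complex.normSq_apply]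
  simp
  ring

omit [FiniteDimensional ℝ E] [MeasurableSpace E] [BorelSpace E] in
/-- Coordinates of a finite linear combination of an orthonormal basis: `⟪e_l, ∑ r_m e_m⟫ = r_l`.
[folklore] -/
theorem inner_sum_smul_orthonormalBasis {ι : Type*} [Fintype ι] (e : OrthonormalBasis ι ℝ E)
    (r : ι → ℝ) (l : ι) : ⟪e l, ∑ m, r m • e m⟫ = r l := by
  classical
  rw [inner_sum]
  simp_rw [real_inner_smul_right]
  rw [Finset.sum_eq_single l]
  · simp [e.orthonormal.1 l]
  · intro m _ hml
    rw [e.orthonormal.2 hml.symm]; ring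
  · intro h; exact absurd (Finset.mem_univ l) h

omit [FiniteDimensional ℝ E] [MeasurableSpace E] [BorelSpace E] in
/-- `‖∑ r_m e_m‖² = ∑ r_m²` for an orthonormal basis. [folklore] -/
theorem norm_sq_sum_smul_orthonormalBasis {ι : Type*} [Fintype ι] (e : OrthonormalBasis ι ℝ E)
    (r : ι → ℝ) : ‖∑ m, r m • e m‖ ^ 2 = ∑ l, r l ^ 2 := by
  rw [← e.sum_sq_inner_right]
  exact Finset.sum_congr rfl fun l _ => by rw [inner_sum_smul_orthonormalBasis]

omit [FiniteDimensional ℝ E] [MeasurableSpace E] [BorelSpace E] in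
/-- **The `ℓ²` bound on the Oseen–Leray symbol** (Koch–Tataru 2001, Lemma 3.2, Step 3: "we have
dispensed with `Π`, which is a bounded operator in `L²`"): the symbol of `z ↦ ⟪K(τ,z)[a,b], c⟫`
without its Gaussian factor is `m(ξ)[a,b,c] = 2πi ⟪ξ,a⟫ ⟪P(ξ)b, c⟫` (`fourier_inner_oseenKernel_eq_leraySymbol`);
for an orthonormal basis `e` and complex coefficients `W_{kl}`,
`∑_j |∑_{k,l} m(ξ)[e_k,e_l,e_j] W_{kl}|² ≤ (2π)² |ξ|² ∑_{k,l} |W_{kl}|²` — `Π∇·` costs at most `2π|ξ|`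
from `ℓ²` tensors to vectors, pointwise in `ξ` (`‖P(ξ)‖ ≤ 1`, `norm_leraySymbol_apply_le`, and
Cauchy–Schwarz `|∑_k ξ_k W_{kl}|² ≤ |ξ|² ∑_k |W_{kl}|²`). [cite: KochTataruAdvMath2001, Lemma 3.2 (Step 3)] -/
theorem sum_norm_sq_sum_oseenSymbol_mul_le {ι : Type*} [Fintype ι] (e : OrthonormalBasis ι ℝ E) (ξ : E)
    (W : ι → ι → ℂ) :
    ∑ j, ‖∑ k, ∑ l, (2 * π * Complex.I * (⟪ξ, e k⟫ : ℝ) * (⟪leraySymbol ξ (e l), e j⟫ : ℝ)) * W k l‖ ^ 2 ≤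
      (2 * π) ^ 2 * ‖ξ‖ ^ 2 * ∑ k, ∑ l, ‖W k l‖ ^ 2 := by
  classical
  -- `c_l = ∑_k ⟪ξ, e_k⟫ W_{kl}`, `x = ∑_l Re c_l • e_l`, `y = ∑_l Im c_l • e_l`
  set c : ι → ℂ := fun l => ∑ k, ((⟪ξ, e k⟫ : ℝ) : ℂ) * W k l with hc
  set x : E := ∑ l, (c l).re • e l with hx
  set y : E := ∑ l, (c l).im • e l with hy
  -- the `j`-th entry is `2πi (⟪P x, e_j⟫ + i ⟪P y, e_j⟫)`
  have hentry : ∀ j, ∑ k, ∑ l, (2 * π * Complex.I * (⟪ξ, e k⟫ : ℝ) * (⟪leraySymbol ξ (e l), e j⟫ : ℝ)) * W k l =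
      2 * π * Complex.I * (((⟪leraySymbol ξ x, e j⟫ : ℝ) : ℂ) +
        ((⟪leraySymbol ξ y, e j⟫ : ℝ) : ℂ) * Complex.I) := by
    intro j
    have h1 : ∑ k, ∑ l, (2 * π * Complex.I * (⟪ξ, e k⟫ : ℝ) * (⟪leraySymbol ξ (e l), e j⟫ : ℝ)) * W k l =
        2 * π * Complex.I * ∑ l, ((⟪leraySymbol ξ (e l), e j⟫ : ℝ) : ℂ) * c l := by
      rw [Finset.sum_comm, Finset.mul_sum]
      refine Finset.sum_congr rfl fun l _ => ?_
      rw [hc]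
      dsimp only
      rw [Finset.mul_sum, Finset.mul_sum]
      refine Finset.sum_congr rfl fun k _ => ?_
      ring
    have h2 : ∀ z : E, ((⟪leraySymbol ξ z, e j⟫ : ℝ) : ℂ) =
        ∑ l, ((⟪leraySymbol ξ (e l), e j⟫ : ℝ) : ℂ) * ((⟪e l, z⟫ : ℝ) : ℂ) := by
      intro z
      conv_lhs => rw [← e.sum_repr' z]
      rw [map_sum, sum_inner]
      push_cast
      refine Finset.sum_congr rfl fun l _ => ?_
      rw [map_smul, real_inner_smul_left]
      push_cast
      ring
    have hxre : ∀ l, ⟪e l, x⟫ = (c l).re := fun l => inner_sum_smul_orthonormalBasis e _ l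
    have hyim : ∀ l, ⟪e l, y⟫ = (c l).im := fun l => inner_sum_smul_orthonormalBasis e _ l
    rw [h1, h2 x, h2 y, Finset.sum_mul, ← Finset.sum_add_distrib]
    congr 1
    refine Finset.sum_congr rfl fun l _ => ?_
    rw [hxre, hyim]
    conv_lhs => rw [← Complex.re_add_im (c l)]
    ring
  -- `∑_j |entry_j|² = 4π² (‖P x‖² + ‖P y‖²) ≤ 4π² (‖x‖² + ‖y‖²) = 4π² ∑_l |c_l|²`
  have hsum : ∑ j, ‖∑ k, ∑ l, (2 * π * Complex.I * (⟪ξ, e k⟫ : ℝ) * (⟪leraySymbol ξ (e l), e j⟫ : ℝ)) *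
      W k l‖ ^ 2 = (2 * π) ^ 2 * (‖leraySymbol ξ x‖ ^ 2 + ‖leraySymbol ξ y‖ ^ 2) := by
    simp_rw [hentry, norm_mul, mul_pow, norm_sq_ofReal_add_ofReal_mul_I]
    rw [← Finset.mul_sum, Finset.sum_add_distrib, e.sum_sq_inner_left, e.sum_sq_inner_left]
    congr 1
    simp [abs_of_pos Real.pi_pos]
  have hxy : ‖x‖ ^ 2 + ‖y‖ ^ 2 = ∑ l, ‖c l‖ ^ 2 := by
    rw [hx, hy, norm_sq_sum_smul_orthonormalBasis, norm_sq_sum_smul_orthonormalBasis,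
      ← Finset.sum_add_distrib]
    refine Finset.sum_congr rfl fun l _ => ?_
    rw [Complex.sq_norm, Complex.normSq_apply]; ring
  -- Cauchy–Schwarz: `|c_l|² ≤ |ξ|² ∑_k |W_{kl}|²`
  have hcl : ∀ l, ‖c l‖ ^ 2 ≤ ‖ξ‖ ^ 2 * ∑ k, ‖W k l‖ ^ 2 := by
    intro l
    have h1 : ‖c l‖ ≤ ∑ k, |⟪ξ, e k⟫| * ‖W k l‖ := by
      rw [hc]
      refine (norm_sum_le _ _).trans (le_of_eq (Finset.sum_congr rfl fun k _ => ?_))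
      rw [norm_mul, Complex.norm_real, Real.norm_eq_abs]
    have h2 : (∑ k, |⟪ξ, e k⟫| * ‖W k l‖) ^ 2 ≤ (∑ k, |⟪ξ, e k⟫| ^ 2) * ∑ k, ‖W k l‖ ^ 2 :=
      Finset.sum_mul_sq_le_sq_mul_sq _ _ _
    have h3 : ∑ k, |⟪ξ, e k⟫| ^ 2 = ‖ξ‖ ^ 2 := by
      rw [← e.sum_sq_inner_left ξ]
      exact Finset.sum_congr rfl fun k _ => sq_abs _
    calc ‖c l‖ ^ 2 ≤ (∑ k, |⟪ξ, e k⟫| * ‖W k l‖) ^ 2 := by gcongr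
      _ ≤ ‖ξ‖ ^ 2 * ∑ k, ‖W k l‖ ^ 2 := by rw [← h3]; exact h2
  have hP : ‖leraySymbol ξ x‖ ^ 2 + ‖leraySymbol ξ y‖ ^ 2 ≤ ‖x‖ ^ 2 + ‖y‖ ^ 2 := by
    gcongr
    · exact norm_leraySymbol_apply_le ξ x
    · exact norm_leraySymbol_apply_le ξ y
  calc ∑ j, ‖∑ k, ∑ l, (2 * π * Complex.I * (⟪ξ, e k⟫ : ℝ) * (⟪leraySymbol ξ (e l), e j⟫ : ℝ)) * W k l‖ ^ 2
      = (2 * π) ^ 2 * (‖leraySymbol ξ x‖ ^ 2 + ‖leraySymbol ξ y‖ ^ 2) := hsum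
    _ ≤ (2 * π) ^ 2 * (‖x‖ ^ 2 + ‖y‖ ^ 2) := by gcongr
    _ = (2 * π) ^ 2 * ∑ l, ‖c l‖ ^ 2 := by rw [hxy]
    _ ≤ (2 * π) ^ 2 * ∑ l, ‖ξ‖ ^ 2 * ∑ k, ‖W k l‖ ^ 2 := by
        gcongr with l
        exact hcl l
    _ = (2 * π) ^ 2 * ‖ξ‖ ^ 2 * ∑ k, ∑ l, ‖W k l‖ ^ 2 := by
        rw [← Finset.mul_sum, Finset.sum_comm, mul_assoc]

end Symbol

/-! ## The kernel on a tensor, in an orthonormal basis -/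

section Basis

omit [FiniteDimensional ℝ E] [MeasurableSpace E] [BorelSpace E] in
/-- **Expansion of the kernel in an orthonormal basis** (bilinearity of `(a, b) ↦ K(τ, z)[a, b]`,
Koch–Tataru 2001, (11): `N(u) = u ⊗ u`):
`K(τ, z)[u, v] = ∑_{k,l} ⟪e_k, u⟫⟪e_l, v⟫ K(τ, z)[e_k, e_l]`. [cite: KochTataruAdvMath2001, (11)] -/
theorem oseenKernel_eq_sum_orthonormalBasis {ι : Type*} [Fintype ι] (e : OrthonormalBasis ι ℝ E) (τ : ℝ)
    (z u v : E) :
    oseenKernel τ z u v = ∑ k, ∑ l, (⟪e k, u⟫ * ⟪e l, v⟫) • oseenKernel τ z (e k) (e l) := by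
  -- the kernel as a bilinear map
  let Kl : E →ₗ[ℝ] E →ₗ[ℝ] E :=
    LinearMap.mk₂ ℝ (oseenKernel τ z) (oseenKernel_add_left τ z)
      (fun c a b => oseenKernel_smul_left τ z c a b) (oseenKernel_add_right τ z)
      (fun c a b => oseenKernel_smul_right τ z c a b)
  have hKl : ∀ a b, Kl a b = oseenKernel τ z a b := fun a b => rfl
  have hu := e.sum_repr' u
  have hv := e.sum_repr' v
  calc oseenKernel τ z u v
      = Kl (∑ k, ⟪e k, u⟫ • e k) (∑ l, ⟪e l, v⟫ • e l) := by rw [hu, hv]; exact (hKl u v).symm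
    _ = ∑ l, Kl (∑ k, ⟪e k, u⟫ • e k) (⟪e l, v⟫ • e l) := by rw [map_sum]
    _ = ∑ l, ∑ k, (⟪e k, u⟫ * ⟪e l, v⟫) • oseenKernel τ z (e k) (e l) := by
        refine Finset.sum_congr rfl fun l _ => ?_
        rw [map_smul, map_sum, LinearMap.sum_apply, Finset.smul_sum]
        refine Finset.sum_congr rfl fun k _ => ?_
        rw [map_smul, LinearMap.smul_apply, hKl, smul_smul, mul_comm]
    _ = ∑ k, ∑ l, (⟪e k, u⟫ * ⟪e l, v⟫) • oseenKernel τ z (e k) (e l) := Finset.sum_comm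

omit [FiniteDimensional ℝ E] [MeasurableSpace E] [BorelSpace E] in
/-- Components of the kernel on a tensor:
`⟪K(τ, z)[u, v], w⟫ = ∑_{k,l} ⟪e_k, u⟫⟪e_l, v⟫ ⟪K(τ, z)[e_k, e_l], w⟫`. [folklore] -/
theorem inner_oseenKernel_eq_sum_orthonormalBasis {ι : Type*} [Fintype ι] (e : OrthonormalBasis ι ℝ E)
    (τ : ℝ) (z u v w : E) :
    ⟪oseenKernel τ z u v, w⟫ = ∑ k, ∑ l, ⟪e k, u⟫ * ⟪e l, v⟫ * ⟪oseenKernel τ z (e k) (e l), w⟫ := by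
  rw [oseenKernel_eq_sum_orthonormalBasis e, sum_inner]
  refine Finset.sum_congr rfl fun k _ => ?_
  rw [sum_inner]
  refine Finset.sum_congr rfl fun l _ => ?_
  rw [real_inner_smul_left]

omit [FiniteDimensional ℝ E] [MeasurableSpace E] [BorelSpace E] in
/-- `‖w‖² = ∑_j ⟪w, e_j⟫²` in `ℝ≥0∞` for the standard orthonormal basis (Parseval in `E`). [folklore] -/
theorem enorm_sq_eq_sum_enorm_inner_sq {ι : Type*} [Fintype ι] (e : OrthonormalBasis ι ℝ E) (w : E) :
    ‖w‖ₑ ^ 2 = ∑ j, ‖⟪w, e j⟫‖ₑ ^ 2 := by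
  rw [← ofReal_norm, ← ENNReal.ofReal_pow (norm_nonneg _), ← e.sum_sq_inner_left,
    ENNReal.ofReal_sum_of_nonneg fun i _ => sq_nonneg _]
  refine Finset.sum_congr rfl fun i _ => ?_
  rw [← ofReal_norm, ← ENNReal.ofReal_pow (norm_nonneg _), Real.norm_eq_abs, sq_abs]

end Basis

/-! ## Parseval for `L¹ ∩ L²` functions, real part -/

section Parseval

variable {F : Type*} [NormedAddCommGroup F] [InnerProductSpace ℂ F] [CompleteSpace F]

omit [CompleteSpace F] in
/-- Polarisation: `‖a + b‖² = ‖a‖² + ‖b‖² + 2 Re ⟪a, b⟫`. [folklore] -/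
theorem norm_add_sq_eq_re (a b : F) : ‖a + b‖ ^ 2 = ‖a‖ ^ 2 + ‖b‖ ^ 2 + 2 * RCLike.re (inner ℂ a b) := by
  rw [@norm_add_sq ℂ]; ring

omit [CompleteSpace F] in
/-- `⟪f, g⟫` is integrable for `f, g ∈ L²` (`|⟪a,b⟫| ≤ ‖a‖‖b‖ ≤ ‖a‖² + ‖b‖²`). [folklore] -/
theorem integrable_inner_of_memLp_two_complex {f g : E → F} (hf : MemLp f 2 volume) (hg : MemLp g 2 volume) :
    Integrable fun x => inner ℂ (f x) (g x) := by
  have h2 : Integrable (fun x => ‖f x‖ ^ 2 + ‖g x‖ ^ 2) :=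
    ((memLp_two_iff_integrable_sq_norm hf.1).1 hf).add ((memLp_two_iff_integrable_sq_norm hg.1).1 hg)
  refine h2.mono' (hf.1.inner hg.1) (Eventually.of_forall fun x => ?_)
  calc ‖inner ℂ (f x) (g x)‖ ≤ ‖f x‖ * ‖g x‖ := norm_inner_le_norm _ _
    _ ≤ ‖f x‖ ^ 2 + ‖g x‖ ^ 2 := by
        nlinarith [sq_nonneg (‖f x‖ - ‖g x‖), norm_nonneg (f x), norm_nonneg (g x)]

/-- **Parseval, real part**, for `L¹ ∩ L²` functions with values in a complex Hilbert space:
`Re ∫ ⟪𝓕f, 𝓕g⟫ = Re ∫ ⟪f, g⟫` (polarisation of Plancherel `‖𝓕h‖₂ = ‖h‖₂`,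
`Literature.Analysis.FunctionSpaces.integral_norm_sq_fourierIntegral_eq`, at `h = f + g`).
[folklore] -/
theorem re_integral_inner_fourier_eq {f g : E → F} (hf1 : Integrable f) (hf2 : MemLp f 2)
    (hg1 : Integrable g) (hg2 : MemLp g 2) :
    RCLike.re (∫ ξ, inner ℂ (𝓕 f ξ) (𝓕 g ξ)) = RCLike.re (∫ x, inner ℂ (f x) (g x)) := by
  -- Plancherel for `f`, `g`, `f + g`
  have hPf := FunctionSpaces.integral_norm_sq_fourierIntegral_eq hf1 hf2
  have hPg := FunctionSpaces.integral_norm_sq_fourierIntegral_eq hg1 hg2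
  have hPfg := FunctionSpaces.integral_norm_sq_fourierIntegral_eq (hf1.add hg1) (hf2.add hg2)
  have hFadd : 𝓕 (f + g) = 𝓕 f + 𝓕 g := by
    funext ξ
    simp only [Real.fourier_eq, Pi.add_apply, smul_add]
    exact integral_add ((Real.fourierIntegral_convergent_iff ξ).2 hf1)
      ((Real.fourierIntegral_convergent_iff ξ).2 hg1)
  rw [hFadd] at hPfg
  -- `L²` memberships on the Fourier side
  have hFf2 := FunctionSpaces.memLp_two_fourierIntegral hf1 hf2
  have hFg2 := FunctionSpaces.memLp_two_fourierIntegral hg1 hg2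
  -- integrability of the inner products and the squares
  have hI1 : Integrable fun ξ => inner ℂ (𝓕 f ξ) (𝓕 g ξ) := integrable_inner_of_memLp_two_complex hFf2 hFg2
  have hI2 : Integrable fun x => inner ℂ (f x) (g x) := integrable_inner_of_memLp_two_complex hf2 hg2
  have hsq : ∀ {h : E → F}, MemLp h 2 volume → Integrable fun x => ‖h x‖ ^ 2 := fun hh =>
    (memLp_two_iff_integrable_sq_norm hh.1).1 hh
  -- expand `‖𝓕f + 𝓕g‖²` and `‖f + g‖²` pointwise and integrate
  have e1 : ∫ ξ, ‖(𝓕 f + 𝓕 g) ξ‖ ^ 2 = (∫ ξ, ‖𝓕 f ξ‖ ^ 2) + (∫ ξ, ‖𝓕 g ξ‖ ^ 2) +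
      2 * ∫ ξ, RCLike.re (inner ℂ (𝓕 f ξ) (𝓕 g ξ)) := by
    have : (fun ξ => ‖(𝓕 f + 𝓕 g) ξ‖ ^ 2) = fun ξ => ‖𝓕 f ξ‖ ^ 2 + ‖𝓕 g ξ‖ ^ 2 +
        2 * RCLike.re (inner ℂ (𝓕 f ξ) (𝓕 g ξ)) := funext fun ξ => norm_add_sq_eq_re _ _
    have h12 : Integrable (fun ξ => ‖𝓕 f ξ‖ ^ 2 + ‖𝓕 g ξ‖ ^ 2) := (hsq hFf2).add (hsq hFg2)
    have h3 : Integrable (fun ξ => 2 * RCLike.re (inner ℂ (𝓕 f ξ) (𝓕 g ξ))) := (hI1.re).const_mul 2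
    rw [this, integral_add h12 h3, integral_add (hsq hFf2) (hsq hFg2), integral_const_mul]
  have e2 : ∫ x, ‖(f + g) x‖ ^ 2 = (∫ x, ‖f x‖ ^ 2) + (∫ x, ‖g x‖ ^ 2) +
      2 * ∫ x, RCLike.re (inner ℂ (f x) (g x)) := by
    have : (fun x => ‖(f + g) x‖ ^ 2) = fun x => ‖f x‖ ^ 2 + ‖g x‖ ^ 2 +
        2 * RCLike.re (inner ℂ (f x) (g x)) := funext fun x => norm_add_sq_eq_re _ _
    have h12 : Integrable (fun x => ‖f x‖ ^ 2 + ‖g x‖ ^ 2) := (hsq hf2).add (hsq hg2)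
    have h3 : Integrable (fun x => 2 * RCLike.re (inner ℂ (f x) (g x))) := (hI2.re).const_mul 2
    rw [this, integral_add h12 h3, integral_add (hsq hf2) (hsq hg2), integral_const_mul]
  rw [e1, e2, hPf, hPg] at hPfg
  have hre1 : ∫ ξ, RCLike.re (inner ℂ (𝓕 f ξ) (𝓕 g ξ)) = RCLike.re (∫ ξ, inner ℂ (𝓕 f ξ) (𝓕 g ξ)) :=
    integral_re hI1
  have hre2 : ∫ x, RCLike.re (inner ℂ (f x) (g x)) = RCLike.re (∫ x, inner ℂ (f x) (g x)) :=
    integral_re hI2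
  linarith

/-- **Parseval, real part, scalar case**: for `f, g ∈ L¹ ∩ L²(E; ℂ)`,
`Re ∫ conj(𝓕f) 𝓕g = Re ∫ conj(f) g`. [folklore] -/
theorem re_integral_conj_fourier_mul_eq {f g : E → ℂ} (hf1 : Integrable f) (hf2 : MemLp f 2)
    (hg1 : Integrable g) (hg2 : MemLp g 2) :
    (∫ ξ, conj (𝓕 f ξ) * 𝓕 g ξ).re = (∫ x, conj (f x) * g x).re := by
  have h := re_integral_inner_fourier_eq hf1 hf2 hg1 hg2
  simpa only [RCLike.inner_apply', RCLike.re_to_complex] using h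

end Parseval

/-! ## `L¹ ∩ L^∞ ⊆ L²` -/

section L2

/-- An integrable, essentially bounded function is square integrable:
`∫ ‖f‖² ≤ M ∫ ‖f‖`. [folklore] -/
theorem memLp_two_of_integrable_of_bound {f : E → ℂ} (hf : Integrable f) {M : ℝ}
    (hM : ∀ x, ‖f x‖ ≤ M) : MemLp f 2 volume := by
  rw [memLp_two_iff_integrable_sq_norm hf.aestronglyMeasurable]
  refine (hf.norm.const_mul M).mono' (hf.aestronglyMeasurable.norm.pow 2) (Eventually.of_forall fun x => ?_)
  rw [Real.norm_of_nonneg (sq_nonneg _), sq]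
  exact mul_le_mul_of_nonneg_right (hM x) (norm_nonneg _)

end L2

end Literature.Analysis.FluidPDE
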